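import Literature.Analysis.FluidPDE.LeraySchemeConvergence
import Literature.Analysis.FluidPDE.LeraySchemePressure
import Literature.Analysis.FluidPDE.NormalisedPressureDifferenceLp
import Literature.Analysis.FluidPDE.NormalisedPressureDischarge
import Literature.Analysis.FluidPDE.LocalLerayPressureDecompositionHolds
import HarnessLib

/-!
# The pressures of Leray's regularised scheme: `L^{3/2}` bounds and strong convergence to the
# Riesz pressure of the limit

Analysis/FluidPDE theorem file (no definitions, no named facts). Third file of the proof that
Leray's weak solutions are suitable (`LeraySchemeConvergence.lean`, `LeraySchemePressure.lean`,
`NormalisedPressureDifferenceLp.lean`). Along Leray's regularised scheme with its pressures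
`(J_{φ n} U n, U n, P n)` (classical solutions of the drift system `∂ₜu + ((J_εu)·∇)u = νΔu − ∇p`,
Leray 1934, (5.1), with Leray's bound `‖P n t‖₂ ≤ 9 ‖|J U n t||U n t|‖₂`):

* `IsLerayRegularisedScheme.pressure_slice_eq_polarised` — at every `t ∈ (0, T)` with finite
  dissipation (almost every `t`), `P n t = ¼(p̃[J U n t + U n t] − p̃[J U n t − U n t])`
  (`pressure_eq_polarisedPressure`: the slices are smooth, finite-energy, divergence free and in
  `L⁴` by `H¹ ⊂ L⁶`, so that all pressures are in `L²`);
* `IsLerayRegularisedScheme.exists_lintegral_pressure_slice_le`,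
  `IsLerayRegularisedScheme.lintegral_prod_pressure_le` — the Calderón–Zygmund bound
  `∫|P n t|^{3/2} ≤ C₁ ∫|U n t|³` and its space–time form, uniform in `n` by the `L³` slab bound of
  `LeraySchemeConvergence.lean`;
* `exists_measurable_limit_pressure` — a jointly strongly measurable version `p` of the Riesz
  pressure `t ↦ p̃[u(t)]` of the Leray–Hopf limit `u`;
* `IsLerayRegularisedScheme.tendsto_lintegral_prod_pressure_sub` — **`P n → p` strongly in
  `L^{3/2}` of every slab `(0, T) × ℝ³`** (slice-wise
  `‖P n t − p̃[u t]‖_{3/2} ≤ ¼C(‖aₙ − 2u‖₃‖aₙ + 2u‖₃ + ‖bₙ‖₃²)`, `aₙ = J U n + U n`, `bₙ = J U n − U n`,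
  by the difference bound of `NormalisedPressureDifferenceLp.lean`; Cauchy–Schwarz in time and the
  `L³` convergences `J U n, U n → u`).

This is the pressure half of the passage to the limit in the local energy equality of the
regularised solutions (Caffarelli–Kohn–Nirenberg 1982, Appendix; Lemarié-Rieusset 2016, Thm. 12.2,
Prop. 14.3), the existence input of the tree's proof of the extension step for local energy
solutions (`localEnergySolution_extension_of_memE2`; Lemarié-Rieusset 2016, Thm. 14.8, Step 2).

## References

* J. Leray, Acta Math. 63 (1934), Ch. V §26 (5.1). [Leray1934]
* L. Caffarelli, R. Kohn, L. Nirenberg, CPAM 35 (1982), Appendix. [CaffarelliKohnNirenberg1982]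
* E. M. Stein, *Singular integrals* (1970), Ch. II §4.2 Thm. 3. [Stein1970]
* P. G. Lemarié-Rieusset, *The Navier–Stokes Problem in the 21st Century* (2016), Thm. 12.2,
  Prop. 14.3, Thm. 14.8. [LemarieRieusset2016]
-/

noncomputable section


open MeasureTheory TopologicalSpace Set Function Filter Topology Real ContinuousLinearMap
open scoped InnerProductSpace RealInnerProductSpace ENNReal NNReal Laplacian Convolution ContDiff

namespace Literature.Analysis.FluidPDE

-- nested operator types in the imported pressure files
set_option maxSynthPendingDepth 3

section SliceRegularity

variable {E : Type*} [NormedAddCommGroup E] [InnerProductSpace ℝ E] [FiniteDimensional ℝ E]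
  [MeasurableSpace E] [BorelSpace E]
variable {ν : ℝ} {u₀ : E → E} {φ : ℕ → ContDiffBump (0 : E)} {U : ℕ → ℝ → E → E}

/-- **Almost every slice of every regularised solution has finite dissipation**:
`∫|∇U n t|² < ⊤` for all `n`, for a.e. `t ∈ (0, T)` (Tonelli, countably many `n`). [folklore] -/
theorem IsLerayRegularisedScheme.ae_forall_dissipation_slice_lt_top
    (hS : IsLerayRegularisedScheme ν u₀ φ U) (T : ℝ) :
    ∀ᵐ t ∂(volume.restrict (Ioo (0 : ℝ) T)), ∀ n,
      ∫⁻ x, ENNReal.ofReal (frobeniusNormSq (fderiv ℝ (U n t) x)) < ⊤ := by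
  rw [ae_all_iff]
  intro n
  have hm : AEMeasurable (fun t => ∫⁻ x, ENNReal.ofReal (frobeniusNormSq (fderiv ℝ (U n t) x)))
      (volume.restrict (Ioo (0 : ℝ) T)) :=
    (hS.aemeasurable_dissipation n).mono_measure (Measure.restrict_mono Ioo_subset_Ioi_self le_rfl)
  exact ae_lt_top' hm (hS.dissipation_lt_top n T).ne

/-- `x⁴ ≤ x² + x⁶` and `x³ ≤ x² + x⁶` in `ℝ≥0∞` (split at `x = 1`). [folklore] -/
theorem ennreal_pow_le_sq_add_pow_six (x : ℝ≥0∞) {k : ℕ} (hk2 : 2 ≤ k) (hk6 : k ≤ 6) :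
    x ^ k ≤ x ^ 2 + x ^ 6 := by
  rcases le_total x 1 with h | h
  · exact (pow_le_pow_right_of_le_one' h hk2).trans le_self_add
  · exact (pow_le_pow_right' h hk6).trans le_add_self

/-- **`L² ∩ L⁶ ⊂ L^k` for `2 ≤ k ≤ 6`** (pointwise `|f|^k ≤ |f|² + |f|⁶`). [folklore] -/
theorem memLp_of_memLp_two_of_memLp_six {α : Type*} {m : MeasurableSpace α} {μ : Measure α}
    {F : Type*} [NormedAddCommGroup F] {f : α → F} (h2 : MemLp f 2 μ) (h6 : MemLp f 6 μ)
    {k : ℕ} (hk2 : 2 ≤ k) (hk6 : k ≤ 6) : MemLp f k μ := by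
  have hk0 : (k : ℝ≥0∞) ≠ 0 := by exact_mod_cast (show k ≠ 0 by omega)
  refine ⟨h2.1, ?_⟩
  have hlt : ∫⁻ x, ‖f x‖ₑ ^ k ∂μ < ⊤ := by
    calc ∫⁻ x, ‖f x‖ₑ ^ k ∂μ ≤ ∫⁻ x, (‖f x‖ₑ ^ 2 + ‖f x‖ₑ ^ 6) ∂μ :=
          lintegral_mono fun x => ennreal_pow_le_sq_add_pow_six _ hk2 hk6
      _ = (∫⁻ x, ‖f x‖ₑ ^ 2 ∂μ) + ∫⁻ x, ‖f x‖ₑ ^ 6 ∂μ :=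
          lintegral_add_left' (h2.1.enorm.pow_const _) _
      _ < ⊤ := by
          rw [← eLpNorm_natCast_pow_eq_lintegral μ f two_ne_zero,
            ← eLpNorm_natCast_pow_eq_lintegral μ f (by norm_num : (6 : ℕ) ≠ 0)]
          simp only [Nat.cast_ofNat]
          exact ENNReal.add_lt_top.2 ⟨ENNReal.pow_lt_top h2.eLpNorm_lt_top,
            ENNReal.pow_lt_top h6.eLpNorm_lt_top⟩
  have h := eLpNorm_natCast_pow_eq_lintegral μ f (n := k) (by omega)
  by_contra hcon
  rw [not_lt, top_le_iff] at hcon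
  rw [hcon, ENNReal.top_pow (by omega)] at h
  exact hlt.ne h.symm

/-- **A finite-energy slice with finite dissipation is in `L³`, `L⁴` and `L⁶`** (Sobolev
`H¹(ℝ³) ⊂ L⁶` for the classical gradient of a `C¹` slice, and `L² ∩ L⁶ ⊂ L³ ∩ L⁴`). Requires
`dim E = 3`. [cite: Evans2010, §5.6.1 Thm. 2] -/
theorem IsLerayRegularisedScheme.memLp_slice_of_dissipation (hE : Module.finrank ℝ E = 3)
    (hS : IsLerayRegularisedScheme ν u₀ φ U) (n : ℕ) {t : ℝ} (ht : 0 < t)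
    (hD : ∫⁻ x, ENNReal.ofReal (frobeniusNormSq (fderiv ℝ (U n t) x)) < ⊤) :
    MemLp (U n t) 6 volume ∧ MemLp (U n t) 4 volume ∧ MemLp (U n t) 3 volume := by
  have h2 : MemLp (U n t) 2 volume := hS.memLp n ht.le
  have h6 : MemLp (U n t) 6 volume := by
    refine ⟨h2.1, ?_⟩
    refine (eLpNorm_six_le_frobenius_of_hasWeakGradient hE h2 (hS.hasWeakGradient_slice n ht)).trans_lt ?_
    exact ENNReal.mul_lt_top ENNReal.coe_lt_top (ENNReal.rpow_lt_top_of_nonneg (by norm_num) hD.ne)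
  exact ⟨h6, by simpa using memLp_of_memLp_two_of_memLp_six h2 h6 (k := 4) (by norm_num) (by norm_num),
    by simpa using memLp_of_memLp_two_of_memLp_six h2 h6 (k := 3) (by norm_num) (by norm_num)⟩

end SliceRegularity

section PressureSlice

variable {ν : ℝ} {u₀ : EuclideanSpace ℝ (Fin 3) → EuclideanSpace ℝ (Fin 3)}
  {φ : ℕ → ContDiffBump (0 : EuclideanSpace ℝ (Fin 3))}
  {U : ℕ → ℝ → EuclideanSpace ℝ (Fin 3) → EuclideanSpace ℝ (Fin 3)}
  {P : ℕ → ℝ → EuclideanSpace ℝ (Fin 3) → ℝ}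

/-- `(3, 3, 3/2)` is a Hölder triple. [folklore] -/
private theorem holderTriple_three_three_threeHalves₀ : ENNReal.HolderTriple 3 3 (3 / 2 : ℝ≥0∞) := by
  refine ⟨?_⟩
  have e1 : (3 / 2 : ℝ≥0∞) = ENNReal.ofReal (3 / 2) := by
    rw [ENNReal.ofReal_div_of_pos (by norm_num)]; simp
  have e2 : (3 : ℝ≥0∞) = ENNReal.ofReal 3 := by simp
  rw [e1, e2, ← ENNReal.ofReal_inv_of_pos (by norm_num), ← ENNReal.ofReal_inv_of_pos (by norm_num),
    ← ENNReal.ofReal_add (by norm_num) (by norm_num)]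
  norm_num

/-- `(4, 4, 2)` is a Hölder triple. [folklore] -/
private theorem holderTriple_four_four_two₀ : ENNReal.HolderTriple 4 4 (2 : ℝ≥0∞) := by
  refine ⟨?_⟩
  have e4 : (4 : ℝ≥0∞) = ENNReal.ofReal 4 := by simp
  have e2 : (2 : ℝ≥0∞) = ENNReal.ofReal 2 := by simp
  rw [e4, e2, ← ENNReal.ofReal_inv_of_pos (by norm_num), ← ENNReal.ofReal_inv_of_pos (by norm_num),
    ← ENNReal.ofReal_add (by norm_num) (by norm_num)]
  norm_num

/-- **Hölder for the product of norms**: `‖|f| |g|‖_r ≤ ‖f‖_p ‖g‖_q` for a Hölder triple. [folklore] -/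
theorem eLpNorm_norm_mul_norm_le_holder {α : Type*} {m : MeasurableSpace α} {μ : Measure α}
    {F : Type*} [NormedAddCommGroup F] {f g : α → F} (hf : AEStronglyMeasurable f μ)
    (hg : AEStronglyMeasurable g μ) {p q r : ℝ≥0∞} [ENNReal.HolderTriple p q r] :
    eLpNorm (fun x => ‖f x‖ * ‖g x‖) r μ ≤ eLpNorm f p μ * eLpNorm g q μ := by
  have h := eLpNorm_le_eLpNorm_mul_eLpNorm'_of_norm hf hg (fun a b => ‖a‖ * ‖b‖) 1
    (Eventually.of_forall fun x => by
      rw [NNReal.coe_one, one_mul, Real.norm_eq_abs, abs_of_nonneg (by positivity)]) (p := p) (q := q) (r := r)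
  simpa using h

/-- `‖|v|²‖_r = ‖v‖_{2r}²`, in the form `MemLp (‖v‖²) r` from `MemLp v (2r)` for the pairs
`(r, 2r) = (3/2, 3), (2, 4)`. [folklore] -/
theorem memLp_norm_sq_of_memLp_holder {α : Type*} {m : MeasurableSpace α} {μ : Measure α}
    {F : Type*} [NormedAddCommGroup F] {v : α → F} {p r : ℝ≥0∞} [ENNReal.HolderTriple p p r]
    (hv : MemLp v p μ) : MemLp (fun y => ‖v y‖ ^ 2) r μ := by
  have h := MemLp.of_bilin (fun a b => ‖a‖ * ‖b‖) 1 hv hv (hv.1.norm.mul hv.1.norm)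
    (Eventually.of_forall fun x => by
      rw [← NNReal.coe_le_coe]; push_cast
      rw [Real.norm_eq_abs, abs_of_nonneg (by positivity), one_mul]) (r := r)
  refine h.congr_norm (hv.1.norm.pow 2) (Eventually.of_forall fun x => ?_)
  simp only [Real.norm_eq_abs, pow_two]

/-- `‖|v|²‖_r ≤ ‖v‖_p²` for a Hölder triple `(p, p, r)`. [folklore] -/
theorem eLpNorm_norm_sq_le {α : Type*} {m : MeasurableSpace α} {μ : Measure α}
    {F : Type*} [NormedAddCommGroup F] {v : α → F} (hv : AEStronglyMeasurable v μ)
    {p r : ℝ≥0∞} [ENNReal.HolderTriple p p r] :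
    eLpNorm (fun y => ‖v y‖ ^ 2) r μ ≤ eLpNorm v p μ ^ 2 := by
  have h := eLpNorm_norm_mul_norm_le_holder hv hv (p := p) (q := p) (r := r)
  have e : (fun y => ‖v y‖ * ‖v y‖) = fun y => ‖v y‖ ^ 2 := by funext y; ring
  rw [e] at h
  rwa [pow_two]

/-- **The pressure of a regularised solution is the polarised Riesz pressure at every good time.**
Along Leray's scheme with its pressures (`(J_{φ n}U n, U n, P n)` a classical drift solution on every
`[0, T]`, with Leray's bound `‖P n t‖₂ ≤ 9‖|J U n t||U n t|‖₂`), at every `t ∈ (0, T)` with finite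
dissipation `∫|∇U n t|² < ⊤`:
`P n t = ¼(p̃[J U n t + U n t] − p̃[J U n t − U n t])` (`pressure_eq_polarisedPressure`: the slices are
smooth, finite-energy, divergence free, in `L⁴`, so that all the pressures are in `L²`). Requires
`ℝ³`. [cite: Leray1934, Ch. V §26 (5.1)] -/
theorem IsLerayRegularisedScheme.pressure_slice_eq_polarised
    (hS : IsLerayRegularisedScheme ν u₀ φ U)
    (hP : ∀ n T, 0 < T →
      IsClassicalDriftNSSolutionOn (Icc 0 T) ν (fun t => mollify (φ n) (U n t)) (U n) (P n))
    (hPb : ∀ n t, 0 ≤ t → eLpNorm (P n t) 2 volume ≤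
      ((9 : ℕ) : ℝ≥0∞) * eLpNorm (fun x => ‖mollify (φ n) (U n t) x‖ * ‖U n t x‖) 2 volume)
    (n : ℕ) {T t : ℝ} (ht : t ∈ Ioo 0 T)
    (hD : ∫⁻ x, ENNReal.ofReal (frobeniusNormSq (fderiv ℝ (U n t) x)) < ⊤) :
    P n t = fun x => 4⁻¹ * (normalisedPressure (mollify (φ n) (U n t) + U n t) x -
      normalisedPressure (mollify (φ n) (U n t) - U n t) x) := by
  have hE : Module.finrank ℝ (EuclideanSpace ℝ (Fin 3)) = 3 := by simp
  have hT : 0 < T := ht.1.trans ht.2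
  have hsol := hP n T hT
  have htint : t ∈ interior (Icc (0 : ℝ) T) := by rw [interior_Icc]; exact ht
  have htI : t ∈ Icc (0 : ℝ) T := ⟨ht.1.le, ht.2.le⟩
  -- regularity of the slices
  set V := U n t with hV
  set W := mollify (φ n) (U n t) with hW
  have hVs : ContDiff ℝ ∞ V := hsol.smooth_velocity.contDiff_slice htI
  have hWs : ContDiff ℝ ∞ W := hsol.smooth_drift.contDiff_slice htI
  have hPs : ContDiff ℝ ∞ (P n t) := hsol.smooth_pressure.contDiff_slice htI
  have hdivV : VectorCalculus.IsDivFree V := hsol.divFree t htI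
  have hdivW : VectorCalculus.IsDivFree W := hsol.divFree_drift t htI
  obtain ⟨hV6, hV4, hV3⟩ := hS.memLp_slice_of_dissipation hE n ht.1 hD
  have hV2 : MemLp V 2 volume := hS.memLp n ht.1.le
  have hW2 : MemLp W 2 volume := FunctionSpaces.memLp_normed_convolution (φ n) hV2 one_le_two
  have hW4 : MemLp W 4 volume := FunctionSpaces.memLp_normed_convolution (φ n) hV4 (by norm_num)
  have hfinV : (∫⁻ x, ‖V x‖ₑ ^ 2) < ⊤ := by
    rw [FourierNS.lintegral_enorm_sq_eq_eLpNorm_sq]; exact ENNReal.pow_lt_top hV2.eLpNorm_lt_top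
  have hfinW : (∫⁻ x, ‖W x‖ₑ ^ 2) < ⊤ := by
    rw [FourierNS.lintegral_enorm_sq_eq_eLpNorm_sq]; exact ENNReal.pow_lt_top hW2.eLpNorm_lt_top
  -- `P n t ∈ L²`
  haveI := holderTriple_four_four_two₀
  have hPL2 : MemLp (P n t) 2 volume := by
    refine ⟨hPs.continuous.aestronglyMeasurable, ?_⟩
    refine (hPb n t ht.1.le).trans_lt ?_
    refine ENNReal.mul_lt_top (by simp) ?_
    exact (eLpNorm_norm_mul_norm_le_holder hW4.1 hV4.1 (p := 4) (q := 4) (r := 2)).trans_lt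
      (ENNReal.mul_lt_top hW4.eLpNorm_lt_top hV4.eLpNorm_lt_top)
  -- `p̃[W ± V] ∈ L²`
  obtain ⟨C2, hC2⟩ := stein1970_normalisedPressure_ae_Lp_bound_holds 2 (by norm_num) ENNReal.ofNat_lt_top
  have hpm : ∀ {v : EuclideanSpace ℝ (Fin 3) → EuclideanSpace ℝ (Fin 3)}, ContDiff ℝ ∞ v →
      MemLp v 4 volume → (∫⁻ x, ‖v x‖ₑ ^ 2) < ⊤ → MemLp (normalisedPressure v) 2 volume := by
    intro v hv hv4 hvfin
    have hsq : MemLp (fun y => ‖v y‖ ^ 2) 2 volume := memLp_norm_sq_of_memLp_holder (p := 4) (r := 2) hv4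
    obtain ⟨-, hbound⟩ := hC2 v hv.continuous.aestronglyMeasurable hsq
    obtain ⟨hC2v, -⟩ := laplacian_normalisedPressure_holds v hv hvfin
    exact ⟨hC2v.continuous.aestronglyMeasurable,
      hbound.trans_lt (ENNReal.mul_lt_top ENNReal.coe_lt_top hsq.eLpNorm_lt_top)⟩
  have hVm : AEStronglyMeasurable V volume := hVs.continuous.aestronglyMeasurable
  have hWm : AEStronglyMeasurable W volume := hWs.continuous.aestronglyMeasurable
  have hplus : MemLp (normalisedPressure (W + V)) 2 volume :=
    hpm (hWs.add hVs) (hW4.add hV4) (lintegral_enorm_sq_pi_add_lt_top hVm hWm hfinV hfinW)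
  have hminus : MemLp (normalisedPressure (W - V)) 2 volume :=
    hpm (hWs.sub hVs) (hW4.sub hV4) (lintegral_enorm_sq_pi_sub_lt_top hVm hWm hfinV hfinW)
  -- the Poisson equation and the identification
  have hΔ : ∀ x, Δ (P n t) x = -VectorCalculus.divergence (convect W V) x := fun x =>
    laplacian_pressure_eq_of_isClassicalDriftNSSolutionOn hsol htint x
  exact pressure_eq_polarisedPressure hVs hWs hdivV hdivW hfinV hfinW (contDiff_infty.1 hPs 2) hPL2 hΔ hplus hminus


/-- **The `L^{3/2}` bound of the pressure slices.** There is an absolute constant `C₁ < ∞` such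
that along Leray's scheme with its pressures, at every `t ∈ (0, T)` with finite dissipation,
`∫ |P n t|^{3/2} ≤ C₁ ∫ |U n t|³`: by the identification with the polarised Riesz pressure,
the Calderón–Zygmund bound `‖p̃[v]‖_{3/2} ≤ C ‖v‖₃²` and Young's inequality `‖J U‖₃ ≤ ‖U‖₃`.
Requires `ℝ³`. [cite: Stein1970, Ch. II §4.2 Thm. 3] -/
theorem IsLerayRegularisedScheme.exists_lintegral_pressure_slice_le
    (hS : IsLerayRegularisedScheme ν u₀ φ U)
    (hP : ∀ n T, 0 < T →
      IsClassicalDriftNSSolutionOn (Icc 0 T) ν (fun t => mollify (φ n) (U n t)) (U n) (P n))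
    (hPb : ∀ n t, 0 ≤ t → eLpNorm (P n t) 2 volume ≤
      ((9 : ℕ) : ℝ≥0∞) * eLpNorm (fun x => ‖mollify (φ n) (U n t) x‖ * ‖U n t x‖) 2 volume) :
    ∃ C₁ : ℝ≥0∞, C₁ ≠ ⊤ ∧ ∀ n {T t : ℝ}, t ∈ Ioo 0 T →
      ∫⁻ x, ENNReal.ofReal (frobeniusNormSq (fderiv ℝ (U n t) x)) < ⊤ →
      ∫⁻ x, ‖P n t x‖ₑ ^ (3 / 2 : ℝ) ≤ C₁ * ∫⁻ x, ‖U n t x‖ₑ ^ (3 : ℝ) := by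
  have hE : Module.finrank ℝ (EuclideanSpace ℝ (Fin 3)) = 3 := by simp
  have h32_1 : (1 : ℝ≥0∞) < 3 / 2 := by
    rw [ENNReal.lt_div_iff_mul_lt (Or.inl two_ne_zero) (Or.inl ENNReal.ofNat_ne_top)]; norm_num
  have h32_t : (3 / 2 : ℝ≥0∞) < ⊤ := ENNReal.div_lt_top ENNReal.ofNat_ne_top two_ne_zero
  obtain ⟨C, hCt, hC⟩ := exists_eLpNorm_normalisedPressure_sub_le (p := (3 / 2 : ℝ≥0∞)) h32_1 h32_t
  haveI := holderTriple_three_three_threeHalves₀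
  -- the constant: `(4⁻¹ (C·4 + C·4))^{3/2}` in `lintegral` form
  set C₁ : ℝ≥0∞ := (4⁻¹ * (C * 2 ^ 2 + C * 2 ^ 2)) ^ (3 / 2 : ℝ) with hC₁
  have hC₁t : C₁ ≠ ⊤ := by
    simp only [hC₁]
    refine ENNReal.rpow_ne_top_of_nonneg (by norm_num) ?_
    finiteness
  refine ⟨C₁, hC₁t, fun n T t ht hD => ?_⟩
  -- the slices
  set V := U n t with hV
  set W := mollify (φ n) (U n t) with hW
  obtain ⟨hV6, hV4, hV3⟩ := hS.memLp_slice_of_dissipation hE n ht.1 hD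
  have hW3 : MemLp W 3 volume := FunctionSpaces.memLp_normed_convolution (φ n) hV3 (by norm_num)
  have hW3le : eLpNorm W 3 volume ≤ eLpNorm V 3 volume :=
    FunctionSpaces.eLpNorm_normed_convolution_le (φ n) hV3.1 (by norm_num)
  have hsqp : MemLp (fun y => ‖(W + V) y‖ ^ 2) (3 / 2 : ℝ≥0∞) volume :=
    memLp_norm_sq_of_memLp_holder (p := 3) (r := 3 / 2) (hW3.add hV3)
  have hsqm : MemLp (fun y => ‖(W - V) y‖ ^ 2) (3 / 2 : ℝ≥0∞) volume :=
    memLp_norm_sq_of_memLp_holder (p := 3) (r := 3 / 2) (hW3.sub hV3)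
  -- the two Riesz pressures in `L^{3/2}`
  have hbp : eLpNorm (normalisedPressure (W + V)) (3 / 2) volume ≤ C * (2 * eLpNorm V 3 volume) ^ 2 := by
    refine (eLpNorm_normalisedPressure_le_of_sub_bound hC (hW3.add hV3).1 hsqp).trans ?_
    gcongr
    refine (eLpNorm_norm_sq_le (hW3.add hV3).1 (p := 3) (r := 3 / 2)).trans ?_
    gcongr
    calc eLpNorm (W + V) 3 volume ≤ eLpNorm W 3 volume + eLpNorm V 3 volume := eLpNorm_add_le hW3.1 hV3.1 (by norm_num)
      _ ≤ eLpNorm V 3 volume + eLpNorm V 3 volume := add_le_add hW3le le_rfl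
      _ = 2 * eLpNorm V 3 volume := by ring
  have hbm : eLpNorm (normalisedPressure (W - V)) (3 / 2) volume ≤ C * (2 * eLpNorm V 3 volume) ^ 2 := by
    refine (eLpNorm_normalisedPressure_le_of_sub_bound hC (hW3.sub hV3).1 hsqm).trans ?_
    gcongr
    refine (eLpNorm_norm_sq_le (hW3.sub hV3).1 (p := 3) (r := 3 / 2)).trans ?_
    gcongr
    calc eLpNorm (W - V) 3 volume ≤ eLpNorm W 3 volume + eLpNorm V 3 volume := eLpNorm_sub_le hW3.1 hV3.1 (by norm_num)
      _ ≤ eLpNorm V 3 volume + eLpNorm V 3 volume := add_le_add hW3le le_rfl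
      _ = 2 * eLpNorm V 3 volume := by ring
  -- measurability of the two Riesz pressures (they are `C²`)
  have hVs : ContDiff ℝ ∞ V := (hP n T (ht.1.trans ht.2)).smooth_velocity.contDiff_slice ⟨ht.1.le, ht.2.le⟩
  have hWs : ContDiff ℝ ∞ W := (hP n T (ht.1.trans ht.2)).smooth_drift.contDiff_slice ⟨ht.1.le, ht.2.le⟩
  have hV2 : MemLp V 2 volume := hS.memLp n ht.1.le
  have hW2 : MemLp W 2 volume := FunctionSpaces.memLp_normed_convolution (φ n) hV2 one_le_two
  have hfinV : (∫⁻ x, ‖V x‖ₑ ^ 2) < ⊤ := by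
    rw [FourierNS.lintegral_enorm_sq_eq_eLpNorm_sq]; exact ENNReal.pow_lt_top hV2.eLpNorm_lt_top
  have hfinW : (∫⁻ x, ‖W x‖ₑ ^ 2) < ⊤ := by
    rw [FourierNS.lintegral_enorm_sq_eq_eLpNorm_sq]; exact ENNReal.pow_lt_top hW2.eLpNorm_lt_top
  have hVm : AEStronglyMeasurable V volume := hVs.continuous.aestronglyMeasurable
  have hWm : AEStronglyMeasurable W volume := hWs.continuous.aestronglyMeasurable
  have hmp : AEStronglyMeasurable (normalisedPressure (W + V)) volume :=
    (laplacian_normalisedPressure_holds (W + V) (hWs.add hVs)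
      (lintegral_enorm_sq_pi_add_lt_top hVm hWm hfinV hfinW)).1.continuous.aestronglyMeasurable
  have hmm : AEStronglyMeasurable (normalisedPressure (W - V)) volume :=
    (laplacian_normalisedPressure_holds (W - V) (hWs.sub hVs)
      (lintegral_enorm_sq_pi_sub_lt_top hVm hWm hfinV hfinW)).1.continuous.aestronglyMeasurable
  -- the bound for `P n t`
  have hident := hS.pressure_slice_eq_polarised hP hPb n ht hD
  have hPle : eLpNorm (P n t) (3 / 2) volume ≤ 4⁻¹ * (C * 2 ^ 2 + C * 2 ^ 2) * eLpNorm V 3 volume ^ 2 := by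
    rw [hident]
    have e1 : (fun x => 4⁻¹ * (normalisedPressure (W + V) x - normalisedPressure (W - V) x)) =
        (4⁻¹ : ℝ) • (normalisedPressure (W + V) - normalisedPressure (W - V)) := by
      funext x; simp [smul_eq_mul]
    rw [e1, eLpNorm_const_smul, Real.enorm_eq_ofReal (by norm_num), ENNReal.ofReal_inv_of_pos (by norm_num),
      ENNReal.ofReal_ofNat, mul_assoc]
    gcongr
    calc eLpNorm (normalisedPressure (W + V) - normalisedPressure (W - V)) (3 / 2) volume
        ≤ eLpNorm (normalisedPressure (W + V)) (3 / 2) volume + eLpNorm (normalisedPressure (W - V)) (3 / 2) volume :=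
          eLpNorm_sub_le hmp hmm h32_1.le
      _ ≤ C * (2 * eLpNorm V 3 volume) ^ 2 + C * (2 * eLpNorm V 3 volume) ^ 2 := add_le_add hbp hbm
      _ = (C * 2 ^ 2 + C * 2 ^ 2) * eLpNorm V 3 volume ^ 2 := by ring
  -- pass to lower integrals
  have e32 : ∫⁻ x, ‖P n t x‖ₑ ^ (3 / 2 : ℝ) = eLpNorm (P n t) (3 / 2) volume ^ (3 / 2 : ℝ) := by
    rw [eLpNorm_eq_lintegral_rpow_enorm_toReal (ne_of_gt (lt_trans zero_lt_one h32_1)) h32_t.ne]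
    have htr : ((3 / 2 : ℝ≥0∞)).toReal = 3 / 2 := by
      rw [ENNReal.toReal_div, ENNReal.toReal_ofNat, ENNReal.toReal_ofNat]
    rw [htr, ← ENNReal.rpow_mul, one_div, inv_mul_cancel₀ (by norm_num : (3 / 2 : ℝ) ≠ 0), ENNReal.rpow_one]
  have e3 : ∫⁻ x, ‖V x‖ₑ ^ (3 : ℝ) = eLpNorm V 3 volume ^ (3 : ℝ) := by
    rw [eLpNorm_eq_lintegral_rpow_enorm_toReal (by norm_num) (by norm_num), ENNReal.toReal_ofNat,
      ← ENNReal.rpow_mul, one_div, inv_mul_cancel₀ (by norm_num : (3 : ℝ) ≠ 0), ENNReal.rpow_one]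
  rw [e32, e3]
  calc eLpNorm (P n t) (3 / 2) volume ^ (3 / 2 : ℝ)
      ≤ (4⁻¹ * (C * 2 ^ 2 + C * 2 ^ 2) * eLpNorm V 3 volume ^ 2) ^ (3 / 2 : ℝ) :=
        ENNReal.rpow_le_rpow hPle (by norm_num)
    _ = C₁ * eLpNorm V 3 volume ^ (3 : ℝ) := by
        rw [ENNReal.mul_rpow_of_nonneg _ _ (by norm_num), hC₁]
        congr 1
        rw [← ENNReal.rpow_natCast, ← ENNReal.rpow_mul]
        norm_num

end PressureSlice

section PressureSlab

variable {ν : ℝ} {u₀ : EuclideanSpace ℝ (Fin 3) → EuclideanSpace ℝ (Fin 3)}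
  {φ : ℕ → ContDiffBump (0 : EuclideanSpace ℝ (Fin 3))}
  {U : ℕ → ℝ → EuclideanSpace ℝ (Fin 3) → EuclideanSpace ℝ (Fin 3)}
  {P : ℕ → ℝ → EuclideanSpace ℝ (Fin 3) → ℝ}
  {u : ℝ → EuclideanSpace ℝ (Fin 3) → EuclideanSpace ℝ (Fin 3)}

/-- A field jointly smooth on `[0, T] × ℝ³` is a.e. strongly measurable for the slab product
measure of `(0, T) × ℝ³`. [folklore] -/
theorem aestronglyMeasurable_prod_of_isSmoothSpaceTimeOn_Icc {F : Type*} [NormedAddCommGroup F]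
    [NormedSpace ℝ F] {w : ℝ → EuclideanSpace ℝ (Fin 3) → F} {T : ℝ} (hw : IsSmoothSpaceTimeOn (Icc 0 T) w) :
    AEStronglyMeasurable (uncurry w)
      ((volume.restrict (Ioo (0 : ℝ) T)).prod (volume : Measure (EuclideanSpace ℝ (Fin 3)))) := by
  rw [restrict_prod_volume_eq]
  have hc : ContinuousOn (uncurry w) (Ioo (0 : ℝ) T ×ˢ (univ : Set (EuclideanSpace ℝ (Fin 3)))) :=
    hw.continuousOn.mono (prod_mono Ioo_subset_Icc_self subset_rfl)
  exact hc.aestronglyMeasurable (measurableSet_Ioo.prod MeasurableSet.univ)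

/-- **The pressures are a.e. strongly measurable on every slab.** [folklore] -/
theorem aestronglyMeasurable_pressure_prod
    (hP : ∀ n T, 0 < T →
      IsClassicalDriftNSSolutionOn (Icc 0 T) ν (fun t => mollify (φ n) (U n t)) (U n) (P n))
    (n : ℕ) {T : ℝ} (hT : 0 < T) :
    AEStronglyMeasurable (uncurry (P n))
      ((volume.restrict (Ioo (0 : ℝ) T)).prod (volume : Measure (EuclideanSpace ℝ (Fin 3)))) :=
  aestronglyMeasurable_prod_of_isSmoothSpaceTimeOn_Icc (hP n T hT).smooth_pressure

/-- **The drifts `J_{φ n} U n` are a.e. strongly measurable on every slab.** [folklore] -/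
theorem aestronglyMeasurable_drift_prod
    (hP : ∀ n T, 0 < T →
      IsClassicalDriftNSSolutionOn (Icc 0 T) ν (fun t => mollify (φ n) (U n t)) (U n) (P n))
    (n : ℕ) {T : ℝ} (hT : 0 < T) :
    AEStronglyMeasurable (uncurry fun t => mollify (φ n) (U n t))
      ((volume.restrict (Ioo (0 : ℝ) T)).prod (volume : Measure (EuclideanSpace ℝ (Fin 3)))) :=
  aestronglyMeasurable_prod_of_isSmoothSpaceTimeOn_Icc (hP n T hT).smooth_drift

/-- **The uniform `L^{3/2}` bound of the pressures on slabs**: with the constant `C₁` of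
`exists_lintegral_pressure_slice_le`, `∫₀ᵀ∫ |P n|^{3/2} ≤ C₁ ∫₀ᵀ∫ |U n|³`, which is bounded
uniformly in `n` (`IsLerayRegularisedScheme.lintegral_prod_cube_le`). [cite: CaffarelliKohnNirenberg1982, Appendix] -/
theorem IsLerayRegularisedScheme.lintegral_prod_pressure_le
    (hS : IsLerayRegularisedScheme ν u₀ φ U)
    (hP : ∀ n T, 0 < T →
      IsClassicalDriftNSSolutionOn (Icc 0 T) ν (fun t => mollify (φ n) (U n t)) (U n) (P n))
    {C₁ : ℝ≥0∞}
    (hC₁ : ∀ n {T t : ℝ}, t ∈ Ioo 0 T →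
      ∫⁻ x, ENNReal.ofReal (frobeniusNormSq (fderiv ℝ (U n t) x)) < ⊤ →
      ∫⁻ x, ‖P n t x‖ₑ ^ (3 / 2 : ℝ) ≤ C₁ * ∫⁻ x, ‖U n t x‖ₑ ^ (3 : ℝ))
    (n : ℕ) {T : ℝ} (hT : 0 < T) :
    ∫⁻ z, ‖P n z.1 z.2‖ₑ ^ (3 / 2 : ℝ) ∂((volume.restrict (Ioo (0 : ℝ) T)).prod
        (volume : Measure (EuclideanSpace ℝ (Fin 3)))) ≤
      C₁ * ∫⁻ z, ‖U n z.1 z.2‖ₑ ^ (3 : ℝ) ∂((volume.restrict (Ioo (0 : ℝ) T)).prod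
        (volume : Measure (EuclideanSpace ℝ (Fin 3)))) := by
  set μt : Measure ℝ := volume.restrict (Ioo (0 : ℝ) T) with hμt
  have hPm : AEMeasurable (fun z : ℝ × EuclideanSpace ℝ (Fin 3) => ‖P n z.1 z.2‖ₑ ^ (3 / 2 : ℝ))
      (μt.prod volume) := (aestronglyMeasurable_pressure_prod hP n hT).enorm.pow_const _
  have hUm : AEMeasurable (fun z : ℝ × EuclideanSpace ℝ (Fin 3) => ‖U n z.1 z.2‖ₑ ^ (3 : ℝ))
      (μt.prod volume) := (hS.aestronglyMeasurable_uncurry_slab n T).enorm.pow_const _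
  rw [lintegral_prod _ hPm, lintegral_prod _ hUm, ← lintegral_const_mul'' _ hUm.lintegral_prod_right']
  refine lintegral_mono_ae ?_
  filter_upwards [hS.ae_forall_dissipation_slice_lt_top T,
    ae_restrict_mem (measurableSet_Ioo : MeasurableSet (Ioo (0 : ℝ) T))] with t hD ht
  exact hC₁ n ht (hD n)

/-- **A jointly measurable version of the Riesz pressure of the slices of the limit.** For a
field `u` jointly a.e. strongly measurable on `(0, ∞) × ℝ³` with square-integrable slices there
is `p : ℝ → ℝ³ → ℝ`, jointly strongly measurable, with `p(t) = p̃[u(t)]` a.e. in `x` for a.e.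
`t > 0` (`exists_stronglyMeasurable_normalisedPressure_eq` applied to a strongly measurable
representative; the Riesz pressure does not see null modifications, `normalisedPressure_congr_ae`).
[folklore] -/
theorem exists_measurable_limit_pressure
    (hmeas : AEStronglyMeasurable (uncurry u)
      ((volume.restrict (Ioi (0 : ℝ))).prod (volume : Measure (EuclideanSpace ℝ (Fin 3)))))
    (hL2 : ∀ t, 0 ≤ t → MemLp (u t) 2 volume) :
    ∃ p : ℝ → EuclideanSpace ℝ (Fin 3) → ℝ, StronglyMeasurable (uncurry p) ∧
      ∀ᵐ t ∂(volume.restrict (Ioi (0 : ℝ))), ∀ᵐ x : EuclideanSpace ℝ (Fin 3),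
        p t x = normalisedPressure (u t) x := by
  set μt : Measure ℝ := volume.restrict (Ioi (0 : ℝ)) with hμt
  set w := hmeas.mk (uncurry u) with hw
  have hwm : StronglyMeasurable w := hmeas.stronglyMeasurable_mk
  have huw : uncurry u =ᵐ[μt.prod volume] w := hmeas.ae_eq_mk
  set Uw : ℝ → EuclideanSpace ℝ (Fin 3) → EuclideanSpace ℝ (Fin 3) := fun t y => w (t, y) with hUw
  have hUwm : StronglyMeasurable (uncurry Uw) := by
    have : uncurry Uw = w := by funext z; rfl
    rw [this]; exact hwm
  set G : Set ℝ := {t | Integrable (fun y => ‖Uw t y‖ ^ 2) volume} with hG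
  obtain ⟨g, hgm, hg⟩ := exists_stronglyMeasurable_normalisedPressure_eq (U := Uw) hUwm (G := G)
    (fun t ht => ht)
  refine ⟨fun t x => g (t, x), ?_, ?_⟩
  · have : (uncurry fun t x => g (t, x)) = g := by funext z; rfl
    rw [this]; exact hgm
  · have hslice : ∀ᵐ t ∂μt, u t =ᵐ[volume] fun x => w (t, x) := by
      have h := Measure.ae_ae_of_ae_prod huw
      filter_upwards [h] with t ht
      filter_upwards [ht] with x hx
      exact hx
    filter_upwards [hslice, ae_restrict_mem (measurableSet_Ioi : MeasurableSet (Ioi (0 : ℝ)))] with t ht ht0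
    have htG : t ∈ G := by
      show Integrable (fun y => ‖Uw t y‖ ^ 2) volume
      have h2 : MemLp (Uw t) 2 volume := (hL2 t (le_of_lt ht0)).ae_eq ht
      have := h2.integrable_norm_rpow two_ne_zero ENNReal.ofNat_ne_top
      simpa using this
    filter_upwards [ht] with x hx
    rw [← hg t htG x]
    exact (normalisedPressure_congr_ae ht hx).symm

end PressureSlab

section PressureConvergence

/-- The Riesz pressure of a measurable field with `|w|² ∈ L¹` is a.e. strongly measurable (copy of
the tree's `aestronglyMeasurable_normalisedPressure_of_sq_integrable`, kept local to spare an
import). [folklore] -/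
private theorem aesm_normalisedPressure
    {w : EuclideanSpace ℝ (Fin 3) → EuclideanSpace ℝ (Fin 3)} (hw : AEStronglyMeasurable w volume)
    (hw2 : Integrable (fun y => ‖w y‖ ^ 2) volume) :
    AEStronglyMeasurable (normalisedPressure w) volume := by
  set wt := hw.mk w with hwt
  have hwtm : StronglyMeasurable wt := hw.stronglyMeasurable_mk
  have hae : w =ᵐ[volume] wt := hw.ae_eq_mk
  set Uc : ℝ → EuclideanSpace ℝ (Fin 3) → EuclideanSpace ℝ (Fin 3) := fun _ => wt with hUc
  have hUm : StronglyMeasurable (uncurry Uc) := hwtm.comp_measurable measurable_snd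
  have hint : ∀ t ∈ (univ : Set ℝ), Integrable (fun y => ‖Uc t y‖ ^ 2) volume := by
    intro t _
    refine hw2.congr ?_
    filter_upwards [hae] with y hy
    simp [hUc, hy]
  obtain ⟨g, hgm, hg⟩ := exists_stronglyMeasurable_normalisedPressure_eq hUm hint
  have hgx : StronglyMeasurable fun x : EuclideanSpace ℝ (Fin 3) => g (0, x) :=
    hgm.comp_measurable (measurable_const.prodMk measurable_id)
  refine ⟨fun x => g (0, x), hgx, ?_⟩
  filter_upwards [hae] with x hx
  show normalisedPressure w x = g (0, x)
  rw [← hg 0 (mem_univ _) x]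
  exact normalisedPressure_congr_ae hae hx

/-- Measurability of the Riesz pressure of an `L²` field. [folklore] -/
private theorem aesm_normalisedPressure_of_memLp_two
    {w : EuclideanSpace ℝ (Fin 3) → EuclideanSpace ℝ (Fin 3)} (hw : MemLp w 2 volume) :
    AEStronglyMeasurable (normalisedPressure w) volume :=
  aesm_normalisedPressure hw.1 (by simpa using hw.integrable_norm_rpow two_ne_zero ENNReal.ofNat_ne_top)

/-- `‖f‖₃ ^ r = (∫⁻ ‖f‖ₑ³) ^ (r/3)`. [folklore] -/
theorem eLpNorm_three_rpow_eq {α : Type*} {m : MeasurableSpace α} (μ : Measure α)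
    {F : Type*} [NormedAddCommGroup F] (f : α → F) (r : ℝ) :
    eLpNorm f 3 μ ^ r = (∫⁻ x, ‖f x‖ₑ ^ (3 : ℝ) ∂μ) ^ (r / 3) := by
  rw [eLpNorm_eq_lintegral_rpow_enorm_toReal (by norm_num) (by norm_num), ENNReal.toReal_ofNat,
    ← ENNReal.rpow_mul]
  congr 1
  ring

/-- **The slice estimate for the difference of the polarised pressure and the Riesz pressure of the
limit.** With the constant `C` of `exists_eLpNorm_normalisedPressure_sub_le` at `p = 3/2`, for
`V, W, v ∈ L² ∩ L³(ℝ³)`: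
`∫ |¼(p̃[W+V] − p̃[W−V]) − p̃[v]|^{3/2} ≤ K ((∫|W+V−2v|³)^{1/2} (∫|W+V+2v|³)^{1/2} + ∫|W−V|³)`,
`K = 2^{1/2}(C/4)^{3/2}` (`p̃[2v] = 4p̃[v]`, `p̃[0] = 0`, the difference bound twice, Hölder
`‖|f||g|‖_{3/2} ≤ ‖f‖₃‖g‖₃`). [cite: Stein1970, Ch. II §4.2 Thm. 3] -/
theorem lintegral_polarised_sub_normalisedPressure_le {C : ℝ≥0∞}
    (hC : ∀ a b : EuclideanSpace ℝ (Fin 3) → EuclideanSpace ℝ (Fin 3),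
      AEStronglyMeasurable a volume → AEStronglyMeasurable b volume →
      MemLp (fun y => ‖a y‖ ^ 2) (3 / 2 : ℝ≥0∞) volume → MemLp (fun y => ‖b y‖ ^ 2) (3 / 2 : ℝ≥0∞) volume →
      eLpNorm (fun x => normalisedPressure a x - normalisedPressure b x) (3 / 2 : ℝ≥0∞) volume ≤
        C * eLpNorm (fun y => ‖a y - b y‖ * ‖a y + b y‖) (3 / 2 : ℝ≥0∞) volume)
    {V W v : EuclideanSpace ℝ (Fin 3) → EuclideanSpace ℝ (Fin 3)}
    (hV : MemLp V 3 volume) (hW : MemLp W 3 volume) (hv : MemLp v 3 volume)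
    (hV2 : MemLp V 2 volume) (hW2 : MemLp W 2 volume) (hv2 : MemLp v 2 volume) :
    ∫⁻ x, ‖4⁻¹ * (normalisedPressure (W + V) x - normalisedPressure (W - V) x) - normalisedPressure v x‖ₑ
        ^ (3 / 2 : ℝ) ≤
      (2 ^ ((3 / 2 : ℝ) - 1) * (4⁻¹ * C) ^ (3 / 2 : ℝ)) *
        ((∫⁻ x, ‖(W + V - (2 : ℝ) • v) x‖ₑ ^ (3 : ℝ)) ^ (1 / 2 : ℝ) *
            (∫⁻ x, ‖(W + V + (2 : ℝ) • v) x‖ₑ ^ (3 : ℝ)) ^ (1 / 2 : ℝ) +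
          ∫⁻ x, ‖(W - V) x‖ₑ ^ (3 : ℝ)) := by
  haveI := holderTriple_three_three_threeHalves₀
  have h32_1 : (1 : ℝ≥0∞) < 3 / 2 := by
    rw [ENNReal.lt_div_iff_mul_lt (Or.inl two_ne_zero) (Or.inl ENNReal.ofNat_ne_top)]; norm_num
  have h32_t : (3 / 2 : ℝ≥0∞) < ⊤ := ENNReal.div_lt_top ENNReal.ofNat_ne_top two_ne_zero
  -- the fields
  set a : EuclideanSpace ℝ (Fin 3) → EuclideanSpace ℝ (Fin 3) := W + V with ha
  set b : EuclideanSpace ℝ (Fin 3) → EuclideanSpace ℝ (Fin 3) := W - V with hb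
  set v2 : EuclideanSpace ℝ (Fin 3) → EuclideanSpace ℝ (Fin 3) := (2 : ℝ) • v with hv2def
  have ha3 : MemLp a 3 volume := hW.add hV
  have hb3 : MemLp b 3 volume := hW.sub hV
  have hv23 : MemLp v2 3 volume := hv.const_smul 2
  have h03 : MemLp (0 : EuclideanSpace ℝ (Fin 3) → EuclideanSpace ℝ (Fin 3)) 3 volume := MemLp.zero
  have sq : ∀ {f : EuclideanSpace ℝ (Fin 3) → EuclideanSpace ℝ (Fin 3)}, MemLp f 3 volume →
      MemLp (fun y => ‖f y‖ ^ 2) (3 / 2 : ℝ≥0∞) volume := fun hf =>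
    memLp_norm_sq_of_memLp_holder (p := 3) (r := 3 / 2) hf
  -- pointwise: the difference is `¼((p̃[a] − p̃[2v]) − (p̃[b] − p̃[0]))`
  have hpt : (fun x => 4⁻¹ * (normalisedPressure a x - normalisedPressure b x) - normalisedPressure v x) =
      fun x => 4⁻¹ * ((normalisedPressure a x - normalisedPressure v2 x) -
        (normalisedPressure b x - normalisedPressure 0 x)) := by
    funext x
    rw [hv2def, normalisedPressure_smul, normalisedPressure_zero, Pi.zero_apply]
    ring
  -- measurability of the Riesz pressures
  have hma := aesm_normalisedPressure_of_memLp_two (hW2.add hV2)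
  have hmb := aesm_normalisedPressure_of_memLp_two (hW2.sub hV2)
  have hmv2 := aesm_normalisedPressure_of_memLp_two (hv2.const_smul (2 : ℝ))
  have hm0 := aesm_normalisedPressure_of_memLp_two
    (MemLp.zero : MemLp (0 : EuclideanSpace ℝ (Fin 3) → EuclideanSpace ℝ (Fin 3)) 2 volume)
  have hm1 : AEStronglyMeasurable (fun x => normalisedPressure a x - normalisedPressure v2 x) volume :=
    hma.sub hmv2
  have hm2 : AEStronglyMeasurable (fun x => normalisedPressure b x - normalisedPressure 0 x) volume :=
    hmb.sub hm0
  -- the `L^{3/2}` bound: `‖F‖ ≤ ¼C (X + Y)`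
  set X : ℝ≥0∞ := eLpNorm (a - v2) 3 volume * eLpNorm (a + v2) 3 volume with hX
  set Y : ℝ≥0∞ := eLpNorm b 3 volume * eLpNorm b 3 volume with hY
  have hF : eLpNorm (fun x => 4⁻¹ * (normalisedPressure a x - normalisedPressure b x) - normalisedPressure v x)
      (3 / 2) volume ≤ 4⁻¹ * C * (X + Y) := by
    rw [hpt]
    have e1 : (fun x => 4⁻¹ * ((normalisedPressure a x - normalisedPressure v2 x) -
        (normalisedPressure b x - normalisedPressure 0 x))) =
        (4⁻¹ : ℝ) • fun x => (normalisedPressure a x - normalisedPressure v2 x) -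
          (normalisedPressure b x - normalisedPressure 0 x) := by
      funext x; simp only [Pi.smul_apply, smul_eq_mul]
    rw [e1, eLpNorm_const_smul, Real.enorm_eq_ofReal (by norm_num), ENNReal.ofReal_inv_of_pos (by norm_num),
      ENNReal.ofReal_ofNat, mul_assoc]
    gcongr
    calc eLpNorm (fun x => (normalisedPressure a x - normalisedPressure v2 x) -
          (normalisedPressure b x - normalisedPressure 0 x)) (3 / 2) volume
        ≤ eLpNorm (fun x => normalisedPressure a x - normalisedPressure v2 x) (3 / 2) volume +
          eLpNorm (fun x => normalisedPressure b x - normalisedPressure 0 x) (3 / 2) volume :=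
          eLpNorm_sub_le hm1 hm2 h32_1.le
      _ ≤ C * eLpNorm (fun y => ‖a y - v2 y‖ * ‖a y + v2 y‖) (3 / 2) volume +
          C * eLpNorm (fun y => ‖b y - (0 : EuclideanSpace ℝ (Fin 3) → EuclideanSpace ℝ (Fin 3)) y‖ *
            ‖b y + (0 : EuclideanSpace ℝ (Fin 3) → EuclideanSpace ℝ (Fin 3)) y‖) (3 / 2) volume :=
          add_le_add (hC a v2 ha3.1 hv23.1 (sq ha3) (sq hv23)) (hC b 0 hb3.1 h03.1 (sq hb3) (sq h03))
      _ ≤ C * X + C * Y := by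
          gcongr
          · exact eLpNorm_norm_mul_norm_le_holder (ha3.sub hv23).1 (ha3.add hv23).1 (p := 3) (q := 3) (r := 3 / 2)
          · simp only [Pi.zero_apply, sub_zero, add_zero]
            exact eLpNorm_norm_mul_norm_le_holder hb3.1 hb3.1 (p := 3) (q := 3) (r := 3 / 2)
      _ = C * (X + Y) := by ring
  -- pass to lower integrals
  have e32 : ∫⁻ x, ‖4⁻¹ * (normalisedPressure a x - normalisedPressure b x) - normalisedPressure v x‖ₑ
        ^ (3 / 2 : ℝ) =
      eLpNorm (fun x => 4⁻¹ * (normalisedPressure a x - normalisedPressure b x) - normalisedPressure v x)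
        (3 / 2) volume ^ (3 / 2 : ℝ) := by
    rw [eLpNorm_eq_lintegral_rpow_enorm_toReal (ne_of_gt (lt_trans zero_lt_one h32_1)) h32_t.ne]
    have htr : ((3 / 2 : ℝ≥0∞)).toReal = 3 / 2 := by
      rw [ENNReal.toReal_div, ENNReal.toReal_ofNat, ENNReal.toReal_ofNat]
    rw [htr, ← ENNReal.rpow_mul, one_div, inv_mul_cancel₀ (by norm_num : (3 / 2 : ℝ) ≠ 0), ENNReal.rpow_one]
  rw [e32]
  have hXe : X ^ (3 / 2 : ℝ) = (∫⁻ x, ‖(a - v2) x‖ₑ ^ (3 : ℝ)) ^ (1 / 2 : ℝ) *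
      (∫⁻ x, ‖(a + v2) x‖ₑ ^ (3 : ℝ)) ^ (1 / 2 : ℝ) := by
    rw [hX, ENNReal.mul_rpow_of_nonneg _ _ (by norm_num), eLpNorm_three_rpow_eq, eLpNorm_three_rpow_eq]
    norm_num
  have hYe : Y ^ (3 / 2 : ℝ) = ∫⁻ x, ‖b x‖ₑ ^ (3 : ℝ) := by
    rw [hY, ← pow_two, ← ENNReal.rpow_natCast, ← ENNReal.rpow_mul, eLpNorm_three_rpow_eq]
    norm_num
  calc eLpNorm (fun x => 4⁻¹ * (normalisedPressure a x - normalisedPressure b x) - normalisedPressure v x)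
        (3 / 2) volume ^ (3 / 2 : ℝ)
      ≤ (4⁻¹ * C * (X + Y)) ^ (3 / 2 : ℝ) := ENNReal.rpow_le_rpow hF (by norm_num)
    _ = (4⁻¹ * C) ^ (3 / 2 : ℝ) * (X + Y) ^ (3 / 2 : ℝ) := ENNReal.mul_rpow_of_nonneg _ _ (by norm_num)
    _ ≤ (4⁻¹ * C) ^ (3 / 2 : ℝ) * (2 ^ ((3 / 2 : ℝ) - 1) * (X ^ (3 / 2 : ℝ) + Y ^ (3 / 2 : ℝ))) := by
        gcongr
        exact ENNReal.rpow_add_le_mul_rpow_add_rpow _ _ (by norm_num)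
    _ = (2 ^ ((3 / 2 : ℝ) - 1) * (4⁻¹ * C) ^ (3 / 2 : ℝ)) * (X ^ (3 / 2 : ℝ) + Y ^ (3 / 2 : ℝ)) := by ring
    _ = _ := by rw [hXe, hYe]

end PressureConvergence

section PressureLimit

variable {ν : ℝ} {u₀ : EuclideanSpace ℝ (Fin 3) → EuclideanSpace ℝ (Fin 3)}
  {φ : ℕ → ContDiffBump (0 : EuclideanSpace ℝ (Fin 3))}
  {U : ℕ → ℝ → EuclideanSpace ℝ (Fin 3) → EuclideanSpace ℝ (Fin 3)}
  {P : ℕ → ℝ → EuclideanSpace ℝ (Fin 3) → ℝ}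
  {u : ℝ → EuclideanSpace ℝ (Fin 3) → EuclideanSpace ℝ (Fin 3)}

/-- `‖a + b‖ₑ³ ≤ 4(‖a‖ₑ³ + ‖b‖ₑ³)` (real exponent). [folklore] -/
private theorem enorm_add_rpow_three_le₀ {F : Type*} [NormedAddCommGroup F] (a b : F) :
    ‖a + b‖ₑ ^ (3 : ℝ) ≤ 4 * (‖a‖ₑ ^ (3 : ℝ) + ‖b‖ₑ ^ (3 : ℝ)) := by
  have h := (ENNReal.rpow_le_rpow (enorm_add_le a b) (by norm_num : (0 : ℝ) ≤ 3)).trans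
    (ENNReal.rpow_add_le_mul_rpow_add_rpow ‖a‖ₑ ‖b‖ₑ (by norm_num : (1 : ℝ) ≤ 3))
  have e : (2 : ℝ≥0∞) ^ ((3 : ℝ) - 1) = 4 := by
    rw [show (3 : ℝ) - 1 = 2 by norm_num, ENNReal.rpow_two]; norm_num
  rwa [e] at h

/-- `∫⁻ ‖f + g‖ₑ³ ≤ 4(∫⁻ ‖f‖ₑ³ + ∫⁻ ‖g‖ₑ³)`. [folklore] -/
private theorem lintegral_enorm_add_rpow_three_le₀ {α : Type*} {m : MeasurableSpace α} {μ : Measure α}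
    {F : Type*} [NormedAddCommGroup F] {f g : α → F} (hf : AEStronglyMeasurable f μ) :
    ∫⁻ x, ‖f x + g x‖ₑ ^ (3 : ℝ) ∂μ ≤ 4 * ((∫⁻ x, ‖f x‖ₑ ^ (3 : ℝ) ∂μ) + ∫⁻ x, ‖g x‖ₑ ^ (3 : ℝ) ∂μ) := by
  calc ∫⁻ x, ‖f x + g x‖ₑ ^ (3 : ℝ) ∂μ ≤ ∫⁻ x, 4 * (‖f x‖ₑ ^ (3 : ℝ) + ‖g x‖ₑ ^ (3 : ℝ)) ∂μ :=
        lintegral_mono fun x => enorm_add_rpow_three_le₀ _ _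
    _ = 4 * ((∫⁻ x, ‖f x‖ₑ ^ (3 : ℝ) ∂μ) + ∫⁻ x, ‖g x‖ₑ ^ (3 : ℝ) ∂μ) := by
        rw [lintegral_const_mul' _ _ (by norm_num), lintegral_add_left' (hf.enorm.pow_const _)]

/-- **The pressures of Leray's scheme converge strongly in `L^{3/2}` of every slab to the Riesz
pressure of the limit** (Caffarelli–Kohn–Nirenberg 1982, Appendix; Lemarié-Rieusset 2016,
Thm. 12.2): `∫₀ᵀ∫ |P n − p|^{3/2} → 0` for any jointly measurable version `p` of `t ↦ p̃[u(t)]`.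
Slice-wise (`lintegral_polarised_sub_normalisedPressure_le`) the integrand is bounded by
`K((∫|aₙ|³)^{1/2}(∫|aₙ + 4u|³)^{1/2} + ∫|bₙ|³)` with `aₙ = (J U n − u) + (U n − u)`,
`bₙ = (J U n − u) − (U n − u)`; Cauchy–Schwarz in time and the `L³` convergences of
`LeraySchemeConvergence.lean` conclude. [cite: CaffarelliKohnNirenberg1982, Appendix] -/
theorem IsLerayRegularisedScheme.tendsto_lintegral_prod_pressure_sub
    (hS : IsLerayRegularisedScheme ν u₀ φ U)
    (hP : ∀ n T, 0 < T →
      IsClassicalDriftNSSolutionOn (Icc 0 T) ν (fun t => mollify (φ n) (U n t)) (U n) (P n))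
    (hPb : ∀ n t, 0 ≤ t → eLpNorm (P n t) 2 volume ≤
      ((9 : ℕ) : ℝ≥0∞) * eLpNorm (fun x => ‖mollify (φ n) (U n t) x‖ * ‖U n t x‖) 2 volume)
    (hν : 0 < ν) (hu₀ : MemLp u₀ 2 volume) (hW : IsSliceWeakLimit U u₀ u)
    (hmeas : AEStronglyMeasurable (uncurry u)
      ((volume.restrict (Ioi (0 : ℝ))).prod (volume : Measure (EuclideanSpace ℝ (Fin 3)))))
    (hae : ∀ᵐ t ∂(volume.restrict (Ioi (0 : ℝ))),
      Tendsto (fun n => eLpNorm (U n t - u t) 2 volume) atTop (𝓝 0))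
    {p : ℝ → EuclideanSpace ℝ (Fin 3) → ℝ} (hpm : StronglyMeasurable (uncurry p))
    (hp : ∀ᵐ t ∂(volume.restrict (Ioi (0 : ℝ))), ∀ᵐ x : EuclideanSpace ℝ (Fin 3),
      p t x = normalisedPressure (u t) x)
    {T : ℝ} (hT : 0 < T) :
    Tendsto (fun n => ∫⁻ z, ‖P n z.1 z.2 - p z.1 z.2‖ₑ ^ (3 / 2 : ℝ)
      ∂((volume.restrict (Ioo (0 : ℝ) T)).prod (volume : Measure (EuclideanSpace ℝ (Fin 3)))))
      atTop (𝓝 0) := by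
  have hE : Module.finrank ℝ (EuclideanSpace ℝ (Fin 3)) = 3 := by simp
  set μt : Measure ℝ := volume.restrict (Ioo (0 : ℝ) T) with hμt
  set μT := μt.prod (volume : Measure (EuclideanSpace ℝ (Fin 3))) with hμT
  -- the constant
  have h32_1 : (1 : ℝ≥0∞) < 3 / 2 := by
    rw [ENNReal.lt_div_iff_mul_lt (Or.inl two_ne_zero) (Or.inl ENNReal.ofNat_ne_top)]; norm_num
  have h32_t : (3 / 2 : ℝ≥0∞) < ⊤ := ENNReal.div_lt_top ENNReal.ofNat_ne_top two_ne_zero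
  obtain ⟨C, hCt, hC⟩ := exists_eLpNorm_normalisedPressure_sub_le (p := (3 / 2 : ℝ≥0∞)) h32_1 h32_t
  set K : ℝ≥0∞ := 2 ^ ((3 / 2 : ℝ) - 1) * (4⁻¹ * C) ^ (3 / 2 : ℝ) with hK
  have hKt : K ≠ ⊤ := by
    simp only [hK]
    exact ENNReal.mul_ne_top (ENNReal.rpow_ne_top_of_nonneg (by norm_num) ENNReal.ofNat_ne_top)
      (ENNReal.rpow_ne_top_of_nonneg (by norm_num) (by finiteness))
  -- measurability on the slab
  have hmu : AEStronglyMeasurable (uncurry u) μT := hmeas.mono_measure (prod_restrict_Ioo_le_prod_restrict_Ioi T)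
  have hmU : ∀ n, AEStronglyMeasurable (uncurry (U n)) μT := fun n => hS.aestronglyMeasurable_uncurry_slab n T
  have hmW : ∀ n, AEStronglyMeasurable (uncurry fun t => mollify (φ n) (U n t)) μT := fun n =>
    aestronglyMeasurable_drift_prod hP n hT
  have hmP : ∀ n, AEStronglyMeasurable (uncurry (P n)) μT := fun n => aestronglyMeasurable_pressure_prod hP n hT
  have hmp : AEStronglyMeasurable (uncurry p) μT := hpm.aestronglyMeasurable
  -- the three space–time quantities `α n, β n → 0` and `γ < ∞`
  set α : ℕ → ℝ≥0∞ := fun n => ∫⁻ z, ‖mollify (φ n) (U n z.1) z.2 - u z.1 z.2‖ₑ ^ (3 : ℝ) ∂μT with hα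
  set β : ℕ → ℝ≥0∞ := fun n => ∫⁻ z, ‖U n z.1 z.2 - u z.1 z.2‖ₑ ^ (3 : ℝ) ∂μT with hβ
  set γ : ℝ≥0∞ := ∫⁻ z, ‖u z.1 z.2‖ₑ ^ (3 : ℝ) ∂μT with hγ
  have hα0 : Tendsto α atTop (𝓝 0) := hS.tendsto_lintegral_prod_mollify_sub_cube hE hν hu₀ hW hmeas hae hT.le
  have hβ0 : Tendsto β atTop (𝓝 0) := hS.tendsto_lintegral_prod_sub_cube hE hν hu₀ hW hmeas hae hT.le
  have hγt : γ < ⊤ := hS.lintegral_prod_cube_limit_lt_top hE hν hu₀ hW hmeas hae hT.le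
  -- the slice functionals
  set A : ℕ → ℝ → ℝ≥0∞ := fun n t =>
    ∫⁻ x, ‖(mollify (φ n) (U n t) + U n t - (2 : ℝ) • u t) x‖ₑ ^ (3 : ℝ) with hA
  set B : ℕ → ℝ → ℝ≥0∞ := fun n t =>
    ∫⁻ x, ‖(mollify (φ n) (U n t) + U n t + (2 : ℝ) • u t) x‖ₑ ^ (3 : ℝ) with hB
  set D : ℕ → ℝ → ℝ≥0∞ := fun n t => ∫⁻ x, ‖(mollify (φ n) (U n t) - U n t) x‖ₑ ^ (3 : ℝ) with hD
  -- measurability of the slice functionals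
  have hAm : ∀ n, AEMeasurable (A n) μt := fun n => by
    have h : AEMeasurable (fun z : ℝ × EuclideanSpace ℝ (Fin 3) =>
        ‖(mollify (φ n) (U n z.1) + U n z.1 - (2 : ℝ) • u z.1) z.2‖ₑ ^ (3 : ℝ)) μT :=
      (((hmW n).add (hmU n)).sub (hmu.const_smul (2 : ℝ))).enorm.pow_const _
    exact h.lintegral_prod_right'
  have hBm : ∀ n, AEMeasurable (B n) μt := fun n => by
    have h : AEMeasurable (fun z : ℝ × EuclideanSpace ℝ (Fin 3) =>
        ‖(mollify (φ n) (U n z.1) + U n z.1 + (2 : ℝ) • u z.1) z.2‖ₑ ^ (3 : ℝ)) μT :=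
      (((hmW n).add (hmU n)).add (hmu.const_smul (2 : ℝ))).enorm.pow_const _
    exact h.lintegral_prod_right'
  -- good times
  have hgood : ∀ᵐ t ∂μt, (∀ n, ∫⁻ x, ENNReal.ofReal (frobeniusNormSq (fderiv ℝ (U n t) x)) < ⊤) ∧
      (∫⁻ x, ‖u t x‖ₑ ^ (3 : ℝ) < ⊤) ∧ (∀ᵐ x : EuclideanSpace ℝ (Fin 3), p t x = normalisedPressure (u t) x) ∧
      t ∈ Ioo (0 : ℝ) T := by
    filter_upwards [hS.ae_forall_dissipation_slice_lt_top T,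
      hS.ae_lintegral_cube_slice_lt_top hE hν hu₀ hW hmeas hae hT.le,
      ae_restrict_of_ae_restrict_of_subset Ioo_subset_Ioi_self hp,
      ae_restrict_mem (measurableSet_Ioo : MeasurableSet (Ioo (0 : ℝ) T))] with t h1 h2 h3 h4
    exact ⟨h1, h2, h3, h4⟩
  -- the slice estimate at good times
  have hslice : ∀ n, ∀ᵐ t ∂μt, ∫⁻ x, ‖P n t x - p t x‖ₑ ^ (3 / 2 : ℝ) ≤
      K * ((A n t) ^ (1 / 2 : ℝ) * (B n t) ^ (1 / 2 : ℝ) + D n t) := by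
    intro n
    filter_upwards [hgood] with t ht
    obtain ⟨hD, hu3, hpt, htI⟩ := ht
    obtain ⟨-, -, hV3⟩ := hS.memLp_slice_of_dissipation hE n htI.1 (hD n)
    have hV2 : MemLp (U n t) 2 volume := hS.memLp n htI.1.le
    have hW3 : MemLp (mollify (φ n) (U n t)) 3 volume := FunctionSpaces.memLp_normed_convolution (φ n) hV3 (by norm_num)
    have hW2 : MemLp (mollify (φ n) (U n t)) 2 volume := FunctionSpaces.memLp_normed_convolution (φ n) hV2 one_le_two
    have hu2 : MemLp (u t) 2 volume := hW.memLp t htI.1.le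
    have hut3 : MemLp (u t) 3 volume := by
      refine ⟨hu2.1, ?_⟩
      rw [eLpNorm_eq_lintegral_rpow_enorm_toReal (by norm_num) (by norm_num), ENNReal.toReal_ofNat]
      exact ENNReal.rpow_lt_top_of_nonneg (by norm_num) hu3.ne
    have hident := hS.pressure_slice_eq_polarised hP hPb n htI (hD n)
    calc ∫⁻ x, ‖P n t x - p t x‖ₑ ^ (3 / 2 : ℝ)
        = ∫⁻ x, ‖4⁻¹ * (normalisedPressure (mollify (φ n) (U n t) + U n t) x -
            normalisedPressure (mollify (φ n) (U n t) - U n t) x) - normalisedPressure (u t) x‖ₑ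
              ^ (3 / 2 : ℝ) := by
          refine lintegral_congr_ae ?_
          filter_upwards [hpt] with x hx
          rw [hx, hident]
      _ ≤ K * ((A n t) ^ (1 / 2 : ℝ) * (B n t) ^ (1 / 2 : ℝ) + D n t) :=
          lintegral_polarised_sub_normalisedPressure_le hC hV3 hW3 hut3 hV2 hW2 hu2
  -- integrate over the slab
  have hint : ∀ n, ∫⁻ z, ‖P n z.1 z.2 - p z.1 z.2‖ₑ ^ (3 / 2 : ℝ) ∂μT ≤
      K * ((∫⁻ t, A n t ∂μt) ^ (1 / 2 : ℝ) * (∫⁻ t, B n t ∂μt) ^ (1 / 2 : ℝ) + ∫⁻ t, D n t ∂μt) := by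
    intro n
    have hm : AEMeasurable (fun z : ℝ × EuclideanSpace ℝ (Fin 3) => ‖P n z.1 z.2 - p z.1 z.2‖ₑ ^ (3 / 2 : ℝ)) μT :=
      ((hmP n).sub hmp).enorm.pow_const _
    rw [lintegral_prod _ hm]
    calc ∫⁻ t, (∫⁻ x, ‖P n t x - p t x‖ₑ ^ (3 / 2 : ℝ)) ∂μt
        ≤ ∫⁻ t, K * ((A n t) ^ (1 / 2 : ℝ) * (B n t) ^ (1 / 2 : ℝ) + D n t) ∂μt := lintegral_mono_ae (hslice n)
      _ = K * ((∫⁻ t, (A n t) ^ (1 / 2 : ℝ) * (B n t) ^ (1 / 2 : ℝ) ∂μt) + ∫⁻ t, D n t ∂μt) := by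
          have hm2 : AEMeasurable (fun t => (A n t) ^ (1 / 2 : ℝ) * (B n t) ^ (1 / 2 : ℝ)) μt :=
            ((hAm n).pow_const _).mul ((hBm n).pow_const _)
          rw [lintegral_const_mul' _ _ hKt, lintegral_add_left' hm2]
      _ ≤ K * ((∫⁻ t, A n t ∂μt) ^ (1 / 2 : ℝ) * (∫⁻ t, B n t ∂μt) ^ (1 / 2 : ℝ) + ∫⁻ t, D n t ∂μt) := by
          gcongr
          have h := ENNReal.lintegral_mul_le_Lp_mul_Lq μt Real.HolderConjugate.two_two
            ((hAm n).pow_const (1 / 2 : ℝ)) ((hBm n).pow_const (1 / 2 : ℝ))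
          have e : ∀ (f : ℝ → ℝ≥0∞) (t : ℝ), (f t ^ (1 / 2 : ℝ)) ^ (2 : ℝ) = f t := fun f t => by
            rw [← ENNReal.rpow_mul]; norm_num
          simp only [Pi.mul_apply, e] at h
          exact h
  -- the three time integrals in terms of `α, β, γ`
  have hptA : ∀ n (z : ℝ × EuclideanSpace ℝ (Fin 3)),
      (mollify (φ n) (U n z.1) + U n z.1 - (2 : ℝ) • u z.1) z.2 =
        (mollify (φ n) (U n z.1) z.2 - u z.1 z.2) + (U n z.1 z.2 - u z.1 z.2) := by
    intro n z
    simp only [Pi.add_apply, Pi.sub_apply, two_smul]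
    abel
  have hptB : ∀ n (z : ℝ × EuclideanSpace ℝ (Fin 3)),
      (mollify (φ n) (U n z.1) + U n z.1 + (2 : ℝ) • u z.1) z.2 =
        ((mollify (φ n) (U n z.1) z.2 - u z.1 z.2) + (U n z.1 z.2 - u z.1 z.2)) + (4 : ℝ) • u z.1 z.2 := by
    intro n z
    simp only [Pi.add_apply, Pi.smul_apply]
    rw [show (4 : ℝ) = 2 + 2 by norm_num, add_smul, two_smul]
    abel
  have hptD : ∀ n (z : ℝ × EuclideanSpace ℝ (Fin 3)),
      (mollify (φ n) (U n z.1) - U n z.1) z.2 =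
        (mollify (φ n) (U n z.1) z.2 - u z.1 z.2) + (-(U n z.1 z.2 - u z.1 z.2)) := by
    intro n z
    simp only [Pi.sub_apply]
    abel
  have hmWu : ∀ n, AEStronglyMeasurable (fun z : ℝ × EuclideanSpace ℝ (Fin 3) =>
      mollify (φ n) (U n z.1) z.2 - u z.1 z.2) μT := fun n => (hmW n).sub hmu
  have hIA : ∀ n, ∫⁻ t, A n t ∂μt ≤ 4 * (α n + β n) := by
    intro n
    have hm : AEMeasurable (fun z : ℝ × EuclideanSpace ℝ (Fin 3) =>
        ‖(mollify (φ n) (U n z.1) + U n z.1 - (2 : ℝ) • u z.1) z.2‖ₑ ^ (3 : ℝ)) μT :=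
      (((hmW n).add (hmU n)).sub (hmu.const_smul (2 : ℝ))).enorm.pow_const _
    rw [← lintegral_prod _ hm]
    simp_rw [hptA]
    exact lintegral_enorm_add_rpow_three_le₀ (hmWu n)
  have hIB : ∀ n, ∫⁻ t, B n t ∂μt ≤ 4 * (4 * (α n + β n) + 4 ^ 3 * γ) := by
    intro n
    have hm : AEMeasurable (fun z : ℝ × EuclideanSpace ℝ (Fin 3) =>
        ‖(mollify (φ n) (U n z.1) + U n z.1 + (2 : ℝ) • u z.1) z.2‖ₑ ^ (3 : ℝ)) μT :=
      (((hmW n).add (hmU n)).add (hmu.const_smul (2 : ℝ))).enorm.pow_const _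
    rw [← lintegral_prod _ hm]
    simp_rw [hptB]
    refine (lintegral_enorm_add_rpow_three_le₀ ((hmWu n).add ((hmU n).sub hmu))).trans ?_
    gcongr
    · exact lintegral_enorm_add_rpow_three_le₀ (hmWu n)
    · refine le_of_eq ?_
      rw [← lintegral_const_mul' _ _ (by simp)]
      refine lintegral_congr fun z => ?_
      rw [enorm_smul, ENNReal.mul_rpow_of_nonneg _ _ (by norm_num)]
      congr 1
      rw [Real.enorm_eq_ofReal (by norm_num), ENNReal.ofReal_ofNat,
        show (3 : ℝ) = ((3 : ℕ) : ℝ) by norm_num, ENNReal.rpow_natCast]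
  have hID : ∀ n, ∫⁻ t, D n t ∂μt ≤ 4 * (α n + β n) := by
    intro n
    have hm : AEMeasurable (fun z : ℝ × EuclideanSpace ℝ (Fin 3) =>
        ‖(mollify (φ n) (U n z.1) - U n z.1) z.2‖ₑ ^ (3 : ℝ)) μT :=
      ((hmW n).sub (hmU n)).enorm.pow_const _
    rw [← lintegral_prod _ hm]
    simp_rw [hptD]
    refine (lintegral_enorm_add_rpow_three_le₀ (hmWu n)).trans ?_
    gcongr
    refine le_of_eq (lintegral_congr fun z => ?_)
    rw [enorm_neg]
  -- the majorant tends to zero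
  set bound : ℕ → ℝ≥0∞ := fun n =>
    K * ((4 * (α n + β n)) ^ (1 / 2 : ℝ) * (4 * (4 * (α n + β n) + 4 ^ 3 * γ)) ^ (1 / 2 : ℝ) +
      4 * (α n + β n)) with hbound
  have hle : ∀ n, ∫⁻ z, ‖P n z.1 z.2 - p z.1 z.2‖ₑ ^ (3 / 2 : ℝ) ∂μT ≤ bound n := fun n =>
    (hint n).trans (by
      simp only [hbound]
      gcongr
      · exact hIA n
      · exact hIB n
      · exact hID n)
  have hab : Tendsto (fun n => α n + β n) atTop (𝓝 0) := by
    have h := hα0.add hβ0; rwa [add_zero] at h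
  have h4ab : Tendsto (fun n => 4 * (α n + β n)) atTop (𝓝 0) := by
    have h := ENNReal.Tendsto.const_mul (a := 4) hab (Or.inr (ENNReal.ofNat_ne_top (n := 4))); rwa [mul_zero] at h
  have hsqrtA : Tendsto (fun n => (4 * (α n + β n)) ^ (1 / 2 : ℝ)) atTop (𝓝 0) := by
    have h := ((ENNReal.continuous_rpow_const (y := (1 / 2 : ℝ))).tendsto 0).comp h4ab
    rwa [ENNReal.zero_rpow_of_pos (by norm_num)] at h
  have hBlim : Tendsto (fun n => (4 * (4 * (α n + β n) + 4 ^ 3 * γ)) ^ (1 / 2 : ℝ)) atTop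
      (𝓝 ((4 * (0 + 4 ^ 3 * γ)) ^ (1 / 2 : ℝ))) := by
    refine ((ENNReal.continuous_rpow_const (y := (1 / 2 : ℝ))).tendsto _).comp ?_
    refine ENNReal.Tendsto.const_mul (a := 4) ?_ (Or.inr (ENNReal.ofNat_ne_top (n := 4)))
    exact (h4ab.add tendsto_const_nhds)
  have hfin : (4 * (0 + 4 ^ 3 * γ)) ^ (1 / 2 : ℝ) ≠ ⊤ := by
    refine ENNReal.rpow_ne_top_of_nonneg (by norm_num) ?_
    rw [zero_add]
    exact ENNReal.mul_ne_top ENNReal.ofNat_ne_top (ENNReal.mul_ne_top (by simp) hγt.ne)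
  have hprod : Tendsto (fun n => (4 * (α n + β n)) ^ (1 / 2 : ℝ) *
      (4 * (4 * (α n + β n) + 4 ^ 3 * γ)) ^ (1 / 2 : ℝ)) atTop (𝓝 0) := by
    have h := ENNReal.Tendsto.mul hsqrtA (Or.inr hfin) hBlim (Or.inr ENNReal.zero_ne_top)
    rwa [zero_mul] at h
  have hsum : Tendsto (fun n => (4 * (α n + β n)) ^ (1 / 2 : ℝ) *
      (4 * (4 * (α n + β n) + 4 ^ 3 * γ)) ^ (1 / 2 : ℝ) + 4 * (α n + β n)) atTop (𝓝 0) := by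
    have h := hprod.add h4ab; rwa [add_zero] at h
  have hfinal : Tendsto bound atTop (𝓝 0) := by
    have h := ENNReal.Tendsto.const_mul hsum (Or.inr hKt); rwa [mul_zero] at h
  exact tendsto_of_tendsto_of_tendsto_of_le_of_le tendsto_const_nhds hfinal (fun _ => zero_le) hle

end PressureLimit

end Literature.Analysis.FluidPDE
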